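import Summits.KontsevichZagierPeriods.KontsevichZagierPeriods.Theorems.SoloBlindCellRelations
import Literature.NumberTheory.Transcendental.BakerRelationDecomposition
import Mathlib.Analysis.SpecialFunctions.Complex.Log
import HarnessLib

/-!
# The Kontsevich–Zagier conjecture in dimension `≤ 1`, III: injectivity on cells

**Cells injectivity.** Let `α`, `c_i`, `λ_i > 1`, `d_k`, `τ_k > 0` be real algebraic numbers with
`α + Σ_i c_i log λ_i + Σ_k d_k arctan τ_k = 0`.  Then
`[K(α)] + Σ_i [L(c_i; λ_i)] + Σ_k [A(d_k; τ_k)] ∈ KZ.relations` (`cells_injective`).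

Proof.  Put `ℓ = (log λ_i ; 2 arctan τ_k · I)` and `γ = (c_i ; −(d_k/2)·I)`: complex numbers with
`exp ℓ` algebraic (`λ_i` resp. `exp(2iθ) = ((1−τ²) + 2τ i)/(1+τ²)`) and `γ` algebraic, and
`α + Σ γ ℓ = 0`.  Baker's theorem in decomposition form (`baker_decomposition_complex`) gives
`α = 0` and rational vectors `N_j` with `Σ_m N_{jm} ℓ_m = 0` and `γ_m = Σ_j γ_j N_{jm}`.  Real and
imaginary parts separate logarithms from angles: `Σ_i N_{j,i} log λ_i = 0`,
`Σ_k N_{j,k} arctan τ_k = 0`, `c_i = Σ_{j log} c_j N_{ji}`, `d_k = Σ_{j angle} d_j N_{jk}`.  By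
coefficient additivity `[L(c_i; λ_i)] ≡ Σ_j [L(c_j N_{ji}; λ_i)]`, and for each `j` the family
`i ↦ [L(c_j N_{ji}; λ_i)]` carries the rational relation `N_{j·}` among the `log λ_i`, so it lies
in `relations` by part IIb (peeling); likewise for the angles; and `[K(0)] ≡ 0`.
-/

noncomputable section

open MeasureTheory Set Filter Finset
open scoped BigOperators Topology

namespace Summit.KontsevichZagierPeriods.KontsevichZagierPeriods.Theorems

open Literature.NumberTheory.Transcendental
open Literature.NumberTheory.Transcendental.KZ

namespace SoloBlind

/-! ## Algebraicity helpers -/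

/-- `((1 − τ²) + 2τ·i)`-type numbers: a complex number with real-algebraic real and imaginary
parts `a + b i` is algebraic (with `i` algebraic as a root of `X² + 1`), and real algebraic numbers
are closed under division — packaged as one statement to be used pointwise below. -/
theorem isAlgebraic_ofReal_add_mul_I_of_div {a b x y : ℝ} (ha : IsAlgebraic ℚ a)
    (hb : IsAlgebraic ℚ b) (hx : IsAlgebraic ℚ x) (hy : IsAlgebraic ℚ y) :
    IsAlgebraic ℚ ((a : ℂ) + (b : ℂ) * Complex.I) ∧ IsAlgebraic ℚ (x / y) ∧
      IsAlgebraic ℚ Complex.I := by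
  have hI : IsAlgebraic ℚ Complex.I := by
    refine IsAlgebraic.of_pow two_pos ?_
    rw [Complex.I_sq]
    exact isAlgebraic_one.neg
  refine ⟨?_, ?_, hI⟩
  · exact ((isAlgebraic_algebraMap_iff (A := ℂ) Complex.ofReal_injective).mpr ha).add
      (((isAlgebraic_algebraMap_iff (A := ℂ) Complex.ofReal_injective).mpr hb).mul hI)
  · rw [div_eq_mul_inv]
    exact hx.mul hy.inv

/-- `cos (2 arctan τ) = 2/(1+τ²) − 1`. -/
theorem cos_two_mul_arctan (τ : ℝ) : Real.cos (2 * Real.arctan τ) = 2 / (1 + τ ^ 2) - 1 := by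
  rw [Real.cos_two_mul, Real.cos_sq_arctan]
  ring

/-- `sin (2 arctan τ) = 2τ/(1+τ²)`. -/
theorem sin_two_mul_arctan (τ : ℝ) : Real.sin (2 * Real.arctan τ) = 2 * τ / (1 + τ ^ 2) := by
  have hc : Real.cos (Real.arctan τ) ≠ 0 := (Real.cos_arctan_pos τ).ne'
  have hs : Real.sin (Real.arctan τ) = τ * Real.cos (Real.arctan τ) := by
    have h := Real.tan_eq_sin_div_cos (Real.arctan τ)
    rw [Real.tan_arctan] at h
    exact (div_eq_iff hc).mp h.symm
  have hsq : Real.cos (Real.arctan τ) ^ 2 = 1 / (1 + τ ^ 2) := Real.cos_sq_arctan τ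
  calc Real.sin (2 * Real.arctan τ) = 2 * τ * Real.cos (Real.arctan τ) ^ 2 := by
        rw [Real.sin_two_mul, hs]; ring
    _ = 2 * τ / (1 + τ ^ 2) := by rw [hsq]; ring

/-- `exp (2i arctan τ) = ((1 − τ²) + 2τ i)/(1 + τ²)` is algebraic for `τ` algebraic. -/
theorem isAlgebraic_exp_two_arctan_mul_I {τ : ℝ} (hτ : IsAlgebraic ℚ τ) :
    IsAlgebraic ℚ (Complex.exp (((2 * Real.arctan τ : ℝ) : ℂ) * Complex.I)) := by
  rw [Complex.exp_mul_I, ← Complex.ofReal_cos, ← Complex.ofReal_sin, cos_two_mul_arctan,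
    sin_two_mul_arctan]
  have h1 : IsAlgebraic ℚ (1 + τ ^ 2) := isAlgebraic_one.add (by simpa [sq] using hτ.mul hτ)
  have hcos : IsAlgebraic ℚ (2 / (1 + τ ^ 2) - 1 : ℝ) :=
    (isAlgebraic_ofReal_add_mul_I_of_div hτ hτ (isAlgebraic_nat 2) h1).2.1.sub isAlgebraic_one
  have hsin : IsAlgebraic ℚ (2 * τ / (1 + τ ^ 2) : ℝ) :=
    (isAlgebraic_ofReal_add_mul_I_of_div hτ hτ ((isAlgebraic_nat 2).mul hτ) h1).2.1
  exact (isAlgebraic_ofReal_add_mul_I_of_div hcos hsin hτ hτ).1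

/-! ## Cells injectivity -/

section inj

variable {ιL ιA : Type}

/-- The complex "logarithms" of the cells: `log λ_i` for logarithmic cells, `2i·arctan τ_k` for
arctangent cells. -/
def cellLog (l : ιL → ℝ) (τ : ιA → ℝ) : ιL ⊕ ιA → ℂ :=
  Sum.elim (fun i => ((Real.log (l i) : ℝ) : ℂ))
    (fun k => ((2 * Real.arctan (τ k) : ℝ) : ℂ) * Complex.I)

/-- The complex coefficients: `c_i` for logarithmic cells, `−(d_k/2) i` for arctangent cells. -/
def cellCoeff (c : ιL → ℝ) (d : ιA → ℝ) : ιL ⊕ ιA → ℂ :=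
  Sum.elim (fun i => ((c i : ℝ) : ℂ)) (fun k => ((-d k / 2 : ℝ) : ℂ) * Complex.I)

/-- The product `γ_k ℓ_k` at an angular index is the real number `d_k arctan τ_k`. -/
theorem cellCoeff_mul_cellLog_inr (c : ιL → ℝ) (d : ιA → ℝ) (l : ιL → ℝ) (τ : ιA → ℝ) (k : ιA) :
    cellCoeff c d (Sum.inr k) * cellLog l τ (Sum.inr k) =
      ((d k * Real.arctan (τ k) : ℝ) : ℂ) := by
  simp only [cellCoeff, cellLog, Sum.elim_inr]
  calc ((-d k / 2 : ℝ) : ℂ) * Complex.I * (((2 * Real.arctan (τ k) : ℝ) : ℂ) * Complex.I)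
        = ((-d k / 2 : ℝ) : ℂ) * ((2 * Real.arctan (τ k) : ℝ) : ℂ) * (Complex.I * Complex.I) := by
          ring
    _ = ((d k * Real.arctan (τ k) : ℝ) : ℂ) := by
          rw [Complex.I_mul_I]
          push_cast
          ring

variable [Fintype ιL] [Fintype ιA]

/-- Real part of a rational combination of the cell logarithms: the logarithmic block. -/
theorem re_sum_ratCast_mul_cellLog (l : ιL → ℝ) (τ : ιA → ℝ) (q : ιL ⊕ ιA → ℚ) :
    (∑ m, (q m : ℂ) * cellLog l τ m).re = ∑ i, (q (Sum.inl i) : ℝ) * Real.log (l i) := by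
  rw [Fintype.sum_sum_type, Complex.add_re, Complex.re_sum, Complex.re_sum]
  simp only [cellLog, Sum.elim_inl, Sum.elim_inr, Complex.mul_re, Complex.ratCast_re,
    Complex.ratCast_im, Complex.ofReal_re, Complex.ofReal_im, Complex.im_ofReal_mul,
    Complex.I_re, Complex.I_im, mul_zero, sub_zero, zero_mul, Finset.sum_const_zero, add_zero]

/-- Imaginary part of a rational combination of the cell logarithms: the angular block. -/
theorem im_sum_ratCast_mul_cellLog (l : ιL → ℝ) (τ : ιA → ℝ) (q : ιL ⊕ ιA → ℚ) :
    (∑ m, (q m : ℂ) * cellLog l τ m).im = 2 * ∑ k, (q (Sum.inr k) : ℝ) * Real.arctan (τ k) := by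
  rw [Fintype.sum_sum_type, Complex.add_im, Complex.im_sum, Complex.im_sum, Finset.mul_sum]
  simp only [cellLog, Sum.elim_inl, Sum.elim_inr, Complex.mul_im, Complex.ratCast_re,
    Complex.ratCast_im, Complex.ofReal_re, Complex.ofReal_im, Complex.re_ofReal_mul,
    Complex.I_re, Complex.I_im, mul_zero, zero_mul, add_zero, Finset.sum_const_zero, zero_add,
    mul_one]
  exact Finset.sum_congr rfl fun k _ => by ring

/-- Real part of `Σ_j γ_j N_j` at a logarithmic index. -/
theorem re_sum_cellCoeff_mul_ratCast (c : ιL → ℝ) (d : ιA → ℝ) (q : ιL ⊕ ιA → ℚ) :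
    (∑ j, cellCoeff c d j * (q j : ℂ)).re = ∑ j, c j * (q (Sum.inl j) : ℝ) := by
  rw [Fintype.sum_sum_type, Complex.add_re, Complex.re_sum, Complex.re_sum]
  simp [cellCoeff, Complex.mul_re]

/-- Imaginary part of `Σ_j γ_j N_j` at an angular index. -/
theorem im_sum_cellCoeff_mul_ratCast (c : ιL → ℝ) (d : ιA → ℝ) (q : ιL ⊕ ιA → ℚ) :
    (∑ j, cellCoeff c d j * (q j : ℂ)).im = ∑ j, (-d j / 2) * (q (Sum.inr j) : ℝ) := by
  rw [Fintype.sum_sum_type, Complex.add_im, Complex.im_sum, Complex.im_sum]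
  simp [cellCoeff, Complex.mul_im]

/-- **Cells injectivity.** A vanishing algebraic combination
`α + Σ_i c_i log λ_i + Σ_k d_k arctan τ_k = 0` (`λ_i > 1`, `τ_k > 0`, all parameters real
algebraic) forces `[K(α)] + Σ_i [L(c_i; λ_i)] + Σ_k [A(d_k; τ_k)] ∈ KZ.relations`. -/
theorem cells_injective {α : ℝ} (hα : IsAlgebraic ℚ α) (c l : ιL → ℝ)
    (hc : ∀ i, IsAlgebraic ℚ (c i)) (hl : ∀ i, IsAlgebraic ℚ (l i)) (h1 : ∀ i, 1 < l i)
    (d τ : ιA → ℝ) (hd : ∀ k, IsAlgebraic ℚ (d k)) (hτ : ∀ k, IsAlgebraic ℚ (τ k))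
    (h0 : ∀ k, 0 < τ k)
    (h : α + ∑ i, c i * Real.log (l i) + ∑ k, d k * Real.arctan (τ k) = 0) :
    of (constCell α hα) + ∑ i, of (logCell (c i) (l i) (hc i) (hl i)) +
      ∑ k, of (atanCell (d k) (τ k) (hd k) (hτ k)) ∈ relations := by
  classical
  -- Baker's theorem, decomposition form
  have halg : ∀ m, IsAlgebraic ℚ (Complex.exp (cellLog l τ m)) := by
    rintro (i | k)
    · simp only [cellLog, Sum.elim_inl]
      rw [← Complex.ofReal_exp, Real.exp_log (one_pos.trans (h1 i))]
      exact (isAlgebraic_algebraMap_iff (A := ℂ) Complex.ofReal_injective).mpr (hl i)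
    · simp only [cellLog, Sum.elim_inr]
      exact isAlgebraic_exp_two_arctan_mul_I (hτ k)
  have hγ : ∀ m, IsAlgebraic ℚ (cellCoeff c d m) := by
    rintro (i | k)
    · exact (isAlgebraic_algebraMap_iff (A := ℂ) Complex.ofReal_injective).mpr (hc i)
    · have h' := isAlgebraic_ofReal_add_mul_I_of_div (hd k) (hd k) (hd k).neg (isAlgebraic_nat 2)
      exact ((isAlgebraic_algebraMap_iff (A := ℂ) Complex.ofReal_injective).mpr h'.2.1).mul h'.2.2
  have hzero : (α : ℂ) + ∑ m, cellCoeff c d m * cellLog l τ m = 0 := by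
    rw [Fintype.sum_sum_type]
    simp only [cellCoeff_mul_cellLog_inr]
    simp only [cellCoeff, cellLog, Sum.elim_inl]
    have e : (α : ℂ) + (∑ i, ((c i : ℝ) : ℂ) * ((Real.log (l i) : ℝ) : ℂ) +
        ∑ k, ((d k * Real.arctan (τ k) : ℝ) : ℂ)) =
        ((α + ∑ i, c i * Real.log (l i) + ∑ k, d k * Real.arctan (τ k) : ℝ) : ℂ) := by
      push_cast
      ring
    rw [e, h]
    simp
  obtain ⟨hα0, N, hN, hγN⟩ :=
    baker_decomposition_complex (cellLog l τ) halg
      (show IsAlgebraic ℚ (α : ℂ) from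
        (isAlgebraic_algebraMap_iff (A := ℂ) Complex.ofReal_injective).mpr hα) hγ hzero
  have hα0' : α = 0 := by exact_mod_cast hα0
  -- the rational relations, split into blocks
  have hrelL : ∀ j, ∑ i, (N j (Sum.inl i) : ℝ) * Real.log (l i) = 0 := by
    intro j
    have := congrArg Complex.re (hN j)
    rwa [re_sum_ratCast_mul_cellLog, Complex.zero_re] at this
  have hrelA : ∀ j, ∑ k, (N j (Sum.inr k) : ℝ) * Real.arctan (τ k) = 0 := by
    intro j
    have := congrArg Complex.im (hN j)
    rw [im_sum_ratCast_mul_cellLog, Complex.zero_im] at this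
    linarith
  -- the coefficient identities, split into blocks
  have hcL : ∀ i, c i = ∑ j, c j * (N (Sum.inl j) (Sum.inl i) : ℝ) := by
    intro i
    have := congrArg Complex.re (hγN (Sum.inl i))
    rw [re_sum_cellCoeff_mul_ratCast] at this
    simpa [cellCoeff] using this
  have hdA : ∀ k, d k = ∑ j, d j * (N (Sum.inr j) (Sum.inr k) : ℝ) := by
    intro k
    have := congrArg Complex.im (hγN (Sum.inr k))
    rw [im_sum_cellCoeff_mul_ratCast] at this
    simp [cellCoeff] at this
    have h2 := congrArg (fun z : ℝ => -2 * z) this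
    simp only [Finset.mul_sum] at h2
    have e1 : -2 * (-d k / 2) = d k := by ring
    rw [e1] at h2
    rw [h2]
    exact Finset.sum_congr rfl fun j _ => by ring
  -- the constant cell
  have hK : of (constCell α hα) ∈ relations := by
    subst hα0'
    exact constCell_zero
  -- the logarithmic cells
  have hcN : ∀ j i, IsAlgebraic ℚ (c j * (N (Sum.inl j) (Sum.inl i) : ℝ)) :=
    fun j i => (hc j).mul (isAlgebraic_algebraMap _)
  have hLog : ∑ i, of (logCell (c i) (l i) (hc i) (hl i)) ∈ relations := by
    have hstep : ∀ i, of (logCell (c i) (l i) (hc i) (hl i)) -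
        ∑ j, of (logCell (c j * (N (Sum.inl j) (Sum.inl i) : ℝ)) (l i) (hcN j i) (hl i)) ∈
        relations := by
      intro i
      have hs : IsAlgebraic ℚ (∑ j, c j * (N (Sum.inl j) (Sum.inl i) : ℝ)) := by
        rw [← hcL i]; exact hc i
      rw [logCell_congr (hc := hc i) (hl := hl i) (hcL i) rfl (hc' := hs) (hl' := hl i)]
      exact logCell_coeff_sum univ (fun j => c j * (N (Sum.inl j) (Sum.inl i) : ℝ))
        (fun j => hcN j i) (hl i)
    have hdiff := sum_sub_sum_mem_relations univ _ _ fun i _ => hstep i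
    have hinner : ∑ i, ∑ j, of (logCell (c j * (N (Sum.inl j) (Sum.inl i) : ℝ)) (l i) (hcN j i)
        (hl i)) ∈ relations := by
      rw [Finset.sum_comm]
      refine sum_mem fun j _ => ?_
      exact sum_logCell_ratCoeff_mem_relations (c j) (hc j) (fun i => N (Sum.inl j) (Sum.inl i))
        l hl h1 (hrelL (Sum.inl j))
    have := relations.add_mem hdiff hinner
    simpa using this
  -- the arctangent cells
  have hdN : ∀ j k, IsAlgebraic ℚ (d j * (N (Sum.inr j) (Sum.inr k) : ℝ)) :=
    fun j k => (hd j).mul (isAlgebraic_algebraMap _)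
  have hAtan : ∑ k, of (atanCell (d k) (τ k) (hd k) (hτ k)) ∈ relations := by
    have hstep : ∀ k, of (atanCell (d k) (τ k) (hd k) (hτ k)) -
        ∑ j, of (atanCell (d j * (N (Sum.inr j) (Sum.inr k) : ℝ)) (τ k) (hdN j k) (hτ k)) ∈
        relations := by
      intro k
      have hs : IsAlgebraic ℚ (∑ j, d j * (N (Sum.inr j) (Sum.inr k) : ℝ)) := by
        rw [← hdA k]; exact hd k
      rw [atanCell_congr (hd := hd k) (hτ := hτ k) (hdA k) rfl (hd' := hs) (hτ' := hτ k)]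
      exact atanCell_coeff_sum univ (fun j => d j * (N (Sum.inr j) (Sum.inr k) : ℝ))
        (fun j => hdN j k) (hτ k)
    have hdiff := sum_sub_sum_mem_relations univ _ _ fun k _ => hstep k
    have hinner : ∑ k, ∑ j, of (atanCell (d j * (N (Sum.inr j) (Sum.inr k) : ℝ)) (τ k)
        (hdN j k) (hτ k)) ∈ relations := by
      rw [Finset.sum_comm]
      refine sum_mem fun j _ => ?_
      exact sum_atanCell_ratCoeff_mem_relations (d j) (hd j) (fun k => N (Sum.inr j) (Sum.inr k))
        τ hτ h0 (hrelA (Sum.inr j))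
    have := relations.add_mem hdiff hinner
    simpa using this
  exact relations.add_mem (relations.add_mem hK hLog) hAtan

end inj

end SoloBlind

end Summit.KontsevichZagierPeriods.KontsevichZagierPeriods.Theorems
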